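import Mathlib
import HarnessLib
import HarnessLib.Audit
import Summits.QuantumAdvantage.QuantumAdvantage.Theorems.WalkThreeCharge
import Summits.QuantumAdvantage.QuantumAdvantage.Theorems.RigidityLaws
import Summits.QuantumAdvantage.AdviceFreeQNC0.ConstantBellsDense

/-!
# NamingDial, part C/4 (§3: the promise-collapse law (one excluded value of |u| mod 3 makes the game classically easy)) — support for item stmt-QuantumAdvantage-22907 (`Theses.DWalkThree.RingDenseResidualLt3`)

Cell decomp-qadv, seat lens-1 («grading / quantitative ladder»), generation 17 — land port of the node «NamingDial» (published under the cell's HOME/decomp-qadv-lens-1/g17/NamingDial.lean, record NODE-g17.md; RESIDUAL MODE on DWalkThree:22907). The node file with ONLY the namespace renamed `Theses.NamingDial → Theorems.NamingDial` and split at section boundaries into parts A–D (A, B, C independent; part D imports part A and alone imports the route file Theses.DWalkThree for the BY-NAME `closes`).  Prop-defs = the node's hardness predicate `ExclusionTwoThirds3` (part A, PROVED there), the counting functions `listing`/`wins` and explicit strategies (parts B, C), and the declared residual `NamingLift3` (part D).  Tree facts reused by name, not restated: `DWalk.predHardDWB3`, `two_pow_le_card_odd_class`, `card_odd_filter_le`,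 `three_mul_card_affine_mod_three`, `stake_eq_affine`, `dk3_eq_one_iff`, `Coset21.oddOneOutForm_holds`, `wtPrefix_zero`, `ConstBells.wtPrefix_self`, `Coset21.wtPrefix_succ`, `RigidityLaws.wtPrefix_one`, `Theorems.dWalkThree_ringFixedBellsSharp3`, `Theorems.dWalkThree_ringBShot3`.  No `sorry`, no new axioms, no instances, no notation.

THIS PART: `singleCut`, `singleCut_win_iff`, `promise_one`, `prefixClass`, `firstClassCut`, `promise_two_wins`, `avoid_forces_prefix`, `card_cylinder_le`, `promise_two_law`.

NODE SYNOPSIS (all parts):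

# NamingDial — lens-1 (grading / quantitative ladder) node, cell `decomp-qadv`, generation 17

TARGET (blocker, by name): `Theses.DWalkThree.RingDenseResidualLt3` (stmt-QuantumAdvantage-22907)
`= RingFixedBellsSharp3 → RingBShot3 → RingHardOdd 3`, both hypotheses PROVED in the tree, so the item is
`RingHardOdd 3` (T): Bob's polylog-degree `𝔽₃` strategies win the mod-3 ring game on at most `θ·2^{n-1}` odd inputs.

THE DIAL.  Grade a strategy by HOW MUCH IT MUST NAME.  By the tree's odd-one-out form T′
(`Coset21.oddOneOutForm_holds`) every strategy `y` wins on `u` iff `nae₀ y u ∧ wt u ≢ −c − oddOneOut y u (mod 3)`: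
winning IS excluding one value of the secret `W = |u| mod 3`, the excluded value being named by the REFEREE-assisted
colouring `u ↦ −c − oddOneOut y u` (computed from the hidden class parities).  The rungs, weakest player first:

* E1 DEFINABLE NAMING  — the player himself outputs a polylog-degree `𝔽₃`-colouring `g` and wins iff `g x ≠ D_k x`.
* E2 ONE BLIND BET      — one bell at a fixed cut, rung adaptively (`OneBellDWB3`, PROVED in tree).
* E3 FEW BLIND BETS     — `≤ N^{1/4}` ringing bells (`BShotDWB3`, PROVED in tree).
* E4 MANY BLIND BETS    — all polylog strategies = T.

LAWS PROVED IN THIS FILE (0 sorry):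

* L1 `exclusionTwoThirds3` (rung E1, NEW): no polylog `𝔽₃`-colouring EXCLUDES the stake `D_k` on more than
  `(2/3+ε)` of the odd class — from the tree's prediction law `DWalk.predHardDWB3` by the shift pigeonhole
  `{g ≠ D} = {g+1 = D} ⊔ {g+2 = D}`.  SHARP: `exclusion_sharp` — the constant colouring `1` (degree 0) excludes `D_k` on
  `≥ (2^N − 2)/3` odd inputs (`three_mul_card_dk3_eq_one_le`, the upper twin of the tree's odd-class equidistribution).
* L2 `exchangeLaw`: for EVERY strategy, `#wins_c(y) = Λ₁ + Λ₂`, `Λ_j = #{u : nae₀ ∧ wt u + c + oddOneOut ≡ j}` —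
  wins and correct "listings" of `W` are the same currency at rate ≤ 2 (`listing_le_wins`, `wins_le_two_max`).
* L3 `endpointPair_concentrated` (+ `endpointPair_win_iff`): the degree-0 strategy firing cuts `0` and `n` puts ALL its
  wins on ONE residue (`wt u + c + oddOneOut ≡ c + 2n`) and wins iff `c ≢ n ∧ n + W ≢ 0` (≈ 2/3 of inputs): the listing
  rate `max_j Λ_j / 2ⁿ` already reaches `2/3` at degree 0, so NO listing threshold `π < 2/3` holds and the factor-2
  exchange cannot carry a bound below `T` — the «ListingDial» door is CLOSED (instrument `g17/exp/listing.py`, n ≤ 8: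
  exchange-law violations 0; max listing 0.664 at Y = {0,n}; max win 0.75, 0.6875, 0.672 for n = 3‥8).
* L4 `promise_one` / `promise_two_wins`: give the player ONE value that `W` is NOT and the game collapses — on a promise
  class `{W ≡ r}` a constant single cut wins EVERY input (degree 0), and on `{W ≢ r₀}` the strategy «first cut of prefix
  class `−c−r₀` among the first `K`» wins every input whose class walk hits that class before `K` (all but a `2^{1-K}`
  fraction: `avoid_forces_prefix`).  The hardness of T is exactly the LAST trit: input partitions by the hidden class
  (σ-promise / monodromy classes, `g17/exp/fullclass.py`: the identity-monodromy FULL class is won by `tGuess` w.p. 1.000,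
  N = 4‥10) are classically trivial — the «PromiseDial» door is CLOSED.

NODE EQUATION (honest LADDER; no route requested):
  `RingDenseResidualLt3 ⟸ ExclusionTwoThirds3 [E1 · WEAKER · PROVED here] ∧ NamingLift3 [E1 → RingHardOdd 3 · ≡ T given E1 ·
  IDEA-NEEDED: a two-moduli correlation bound for MANY blind bets]` — `closes` below, by name.  The residual is the blocker
  itself; what this generation adds is the proved rung BELOW the one-bell law and two door-closing laws (L3, L4) with
  kernel witnesses, so that later lens-1 seats do not re-open the listing-threshold or promise-class dials.

WHY EACH PIECE IS STRICTLY WEAKER / EQUIVALENT.  E1 is a theorem (this file) while T is open (probe P1 `E1 → T` fails);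
informally E1 sits below E3 (a named exclusion `W ≠ E(u)` turns into a ≤ 1-ringing-bell strategy — the u-coordinate construction
is `promise_two_wins` with `r₀ :=` the named value); `NamingLift3` is T itself given E1 (declared, not hidden: `lift_of_target`).  WHY NOVEL relative to the other five lenses: no other node grades by the information the player
must NAME (exclusion vs blind bet), none has the exchange identity `wins = Λ₁ + Λ₂` or the promise-collapse law; lens-2
(BlindLoss/pointer readers), lens-3 (Quartic/Perceptron), lens-4 (Unity/Live), lens-5 (Grade/Corner/Restriction), lens-6
(Null/Slice/Orbit) grade strategies or inputs by algebraic shape, not by naming power.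

REPAIR CENSUS (doors tried this generation and why each is closed — evidence in `g17/NODE-g17.md`): degree / depth / prime
gradings (nested ⇒ LADDER, g14–g16); locality by partition (win-neutral scrambling, g15 law) and by domination
(`ringLocal_polylog_lt3` already PROVES the polylog-radius local law ⇒ residual ≡ T); listing threshold (L3 above);
law-shape dial on `wt u + oddOneOut` (a sure value ≠ −c IS near-perfect play ≡ ¬T); promise / monodromy classes (L4);
density-hurts (false: win-neutral gated triples); charge split (three-charge identity ⇒ similar subcases); XOR / direct
product (returns to the untyped (D3-core′)); (degree, sparsity) bi-grading (next rungs are items 27655 / PerfectDial).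
-/

namespace Summit.QuantumAdvantage.QuantumAdvantage.Theorems.NamingDial

set_option linter.dupNamespace false

open Classical
open Finset
open Summit.QuantumAdvantage.AdviceFreeQNC0
open Summit.QuantumAdvantage.AdviceFreeQNC0.Coset21
open Literature.Computability.MetaComplexity Literature.Computability.MetaComplexity.Smolensky

variable {n : ℕ}

/-! ## §3  The promise-collapse law: one excluded value of `W` makes the game classically easy -/

/-- the constant strategy firing the single cut `g₀`. -/
def singleCut (n g₀ : ℕ) : Fin (n + 1) → (Fin n → Bool) → Bool :=
  fun g _ => decide (g.val = g₀)

/-- a single fired cut wins iff it is live. -/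
theorem singleCut_win_iff (n c g₀ : ℕ) (hg₀ : g₀ ≤ n) (u : Fin n → Bool) :
    ringWinU c (singleCut n g₀) u = true ↔ (c + g₀ + walkExp u g₀) % 3 ≠ 0 := by
  unfold ringWinU
  rw [decide_eq_true_eq]
  have hset : (univ.filter fun g : Fin (n + 1) =>
        singleCut n g₀ g u = true ∧ (c + g.val + walkExp u g.val) % 3 ≠ 0)
      = (({⟨g₀, by omega⟩} : Finset (Fin (n + 1))).filter
          fun g => (c + g.val + walkExp u g.val) % 3 ≠ 0) := by
    ext g
    simp only [singleCut, mem_filter, mem_univ, true_and, decide_eq_true_eq, mem_singleton, Fin.ext_iff]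
  rw [hset, filter_singleton]
  by_cases h : (c + g₀ + walkExp u g₀) % 3 ≠ 0
  · rw [if_pos h, card_singleton]; exact ⟨fun _ => h, fun _ => rfl⟩
  · rw [if_neg h, card_empty]; exact ⟨fun h0 => absurd h0 (by norm_num), fun h' => absurd h' h⟩

/-- **L4a PROMISE `|S| = 1`**: told `W ≡ r (mod 3)`, a CONSTANT single cut (cut 0, or cut 1 when `c + r ≡ 0`) wins on EVERY
input of the promise class — degree 0, no error. -/
theorem promise_one (hn : 1 ≤ n) (c r : ℕ) :
    ∃ g₀ : ℕ, g₀ ≤ 1 ∧ ∀ u : Fin n → Bool, wt u % 3 = r % 3 → ringWinU c (singleCut n g₀) u = true := by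
  by_cases h : (c + r) % 3 = 0
  · refine ⟨1, le_rfl, fun u hu => ?_⟩
    rw [singleCut_win_iff n c 1 hn u]
    unfold walkExp
    rw [RigidityLaws.wtPrefix_one hn]
    split_ifs <;> omega
  · refine ⟨0, by omega, fun u hu => ?_⟩
    rw [singleCut_win_iff n c 0 (by omega) u]
    unfold walkExp
    rw [wtPrefix_zero]
    omega

/-- prefix class of cut `g` on input `u`: `(g + wtPrefix u g) mod 3` (computable from the first `g` bits). -/
def prefixClass (u : Fin n → Bool) (g : ℕ) : ℕ := (g + wtPrefix u g) % 3

/-- the strategy «fire the FIRST cut `g < K` whose prefix class is `r⋆`» (a `K`-prefix junta, ≤ 1 ringing bell). -/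
noncomputable def firstClassCut (n K r : ℕ) : Fin (n + 1) → (Fin n → Bool) → Bool :=
  fun g u => decide (g.val < K ∧ prefixClass u g.val = r % 3 ∧ ∀ g' < g.val, prefixClass u g' ≠ r % 3)

/-- **L4b PROMISE `|S| = 2`**: told only `W ≢ r₀ (mod 3)`, the strategy `firstClassCut n K (2c + 2r₀)` (target class
`r⋆ = −c − r₀`, surely live under the promise) wins on EVERY input of the promise class whose prefix-class walk visits `r⋆`
before step `K`. -/
theorem promise_two_wins (n K c r₀ : ℕ) (hK : K ≤ n + 1) (u : Fin n → Bool) (hu : wt u % 3 ≠ r₀ % 3)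
    (hhit : ∃ g, g < K ∧ prefixClass u g = (2 * c + 2 * r₀) % 3) :
    ringWinU c (firstClassCut n K (2 * c + 2 * r₀)) u = true := by
  obtain ⟨hg₁K, hg₁c⟩ := Nat.find_spec hhit
  have hmin : ∀ g' < Nat.find hhit, prefixClass u g' ≠ (2 * c + 2 * r₀) % 3 := by
    intro g' hg' habs
    exact Nat.find_min hhit hg' ⟨lt_trans hg' hg₁K, habs⟩
  unfold ringWinU
  rw [decide_eq_true_eq]
  have hset : (univ.filter fun g : Fin (n + 1) =>
        firstClassCut n K (2 * c + 2 * r₀) g u = true ∧ (c + g.val + walkExp u g.val) % 3 ≠ 0)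
      = {⟨Nat.find hhit, by omega⟩} := by
    ext g
    simp only [firstClassCut, mem_filter, mem_univ, true_and, decide_eq_true_eq, mem_singleton, Fin.ext_iff]
    constructor
    · rintro ⟨⟨hgK, hcls, hfirst⟩, _⟩
      by_contra hne
      rcases lt_or_gt_of_ne hne with hlt | hgt
      · exact hmin g.val hlt hcls
      · exact hfirst _ hgt hg₁c
    · intro hg
      have hcls : prefixClass u g.val = (2 * c + 2 * r₀) % 3 := by rw [hg]; exact hg₁c
      refine ⟨⟨by omega, hcls, fun g' hg' => hmin g' (by omega)⟩, ?_⟩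
      unfold prefixClass at hcls
      unfold walkExp
      omega
  rw [hset, card_singleton]

/-- **L4c AVOIDANCE IS A SINGLE PATH**: if the prefix-class walks of two inputs both avoid `r⋆ ≢ 0` at the cuts `1, …, K`
then their first `K` bits AGREE (the walk moves `+1` on a `0`-bit and `+2` on a `1`-bit, and exactly one of the two moves
lands on `r⋆`).  Hence the non-hit inputs of `promise_two_wins` lie in ONE `K`-prefix cylinder: a `2^{-K}` fraction. -/
theorem avoid_forces_prefix (u v : Fin n → Bool) (r K : ℕ) (hr : r % 3 ≠ 0) (hK : K ≤ n)
    (hu : ∀ g, 1 ≤ g → g ≤ K → prefixClass u g ≠ r % 3)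
    (hv : ∀ g, 1 ≤ g → g ≤ K → prefixClass v g ≠ r % 3) :
    ∀ i : Fin n, i.val < K → u i = v i := by
  have main : ∀ m, m ≤ K → (∀ i : Fin n, i.val < m → u i = v i) ∧ wtPrefix u m = wtPrefix v m := by
    intro m
    induction m with
    | zero =>
      intro _
      exact ⟨fun i hi => absurd hi (Nat.not_lt_zero _), by rw [wtPrefix_zero, wtPrefix_zero]⟩
    | succ m ih =>
      intro hm
      obtain ⟨hbits, hwt⟩ := ih (by omega)
      have hmn : m < n := by omega
      have hcls : (m + wtPrefix u m) % 3 ≠ r % 3 := by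
        rcases Nat.eq_zero_or_pos m with h0 | hpos
        · subst h0; rw [wtPrefix_zero]; omega
        · exact hu m hpos (by omega)
      have hu' := hu (m + 1) (by omega) hm
      have hv' := hv (m + 1) (by omega) hm
      unfold prefixClass at hu' hv'
      rw [Coset21.wtPrefix_succ u m hmn] at hu'
      rw [Coset21.wtPrefix_succ v m hmn, ← hwt] at hv'
      have hbit : u ⟨m, hmn⟩ = v ⟨m, hmn⟩ := by
        cases hub : u ⟨m, hmn⟩ <;> cases hvb : v ⟨m, hmn⟩
        · rfl
        · exfalso; rw [hub] at hu'; rw [hvb] at hv'; simp at hu' hv'; omega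
        · exfalso; rw [hub] at hu'; rw [hvb] at hv'; simp at hu' hv'; omega
        · rfl
      refine ⟨fun i hi => ?_, ?_⟩
      · rcases Nat.lt_succ_iff_lt_or_eq.1 hi with h | h
        · exact hbits i h
        · have : i = ⟨m, hmn⟩ := Fin.ext h
          rw [this]; exact hbit
      · rw [Coset21.wtPrefix_succ u m hmn, Coset21.wtPrefix_succ v m hmn, hwt, hbit]
  intro i hi
  exact (main K le_rfl).1 i hi

/-- a `K`-prefix cylinder has at most `2^{n-K}` points. -/
theorem card_cylinder_le (u₀ : Fin n → Bool) (K : ℕ) (hK : K ≤ n) :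
    (univ.filter fun u : Fin n → Bool => ∀ i : Fin n, i.val < K → u i = u₀ i).card ≤ 2 ^ (n - K) := by
  have hcard : (univ : Finset (Fin (n - K) → Bool)).card = 2 ^ (n - K) := by
    simp
  rw [← hcard]
  refine card_le_card_of_injOn (fun u => fun j : Fin (n - K) => u ⟨K + j.val, by omega⟩) (fun _ _ => mem_univ _) ?_
  intro u hu v hv huv
  simp only [coe_filter, mem_univ, true_and, Set.mem_setOf_eq] at hu hv
  funext i
  by_cases hi : i.val < K
  · rw [hu i hi, hv i hi]
  · have h := congrFun huv ⟨i.val - K, by omega⟩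
    have hi' : (⟨K + (i.val - K), by omega⟩ : Fin n) = i := Fin.ext (by simp; omega)
    simp only [hi'] at h
    exact h

/-- **L4d — THE PROMISE LAW, counted**: under the promise `W ≢ r₀`, the explicit `(K+1)`-prefix strategy
`firstClassCut n (K+1) (2c+2r₀)` (polylog degree for `K = polylog n`) LOSES on at most `2^{n-K}` inputs of the promise
class (`1 ≤ K ≤ n`): one excluded value of `|u| mod 3` collapses the ring game to a classically near-perfect one. -/
theorem promise_two_law (n K c r₀ : ℕ) (hK1 : 1 ≤ K) (hK : K ≤ n) :
    (univ.filter fun u : Fin n → Bool =>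
        wt u % 3 ≠ r₀ % 3 ∧ ringWinU c (firstClassCut n (K + 1) (2 * c + 2 * r₀)) u = false).card
      ≤ 2 ^ (n - K) := by
  set F := univ.filter fun u : Fin n → Bool =>
      wt u % 3 ≠ r₀ % 3 ∧ ringWinU c (firstClassCut n (K + 1) (2 * c + 2 * r₀)) u = false with hF
  -- a losing promise input avoids the target class at every cut `g ≤ K`
  have havoid : ∀ u ∈ F, ∀ g, g ≤ K → prefixClass u g ≠ (2 * c + 2 * r₀) % 3 := by
    intro u hu g hg habs
    simp only [hF, mem_filter, mem_univ, true_and] at hu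
    have hwin := promise_two_wins n (K + 1) c r₀ (by omega) u hu.1 ⟨g, by omega, habs⟩
    rw [hwin] at hu
    exact Bool.noConfusion hu.2
  rcases F.eq_empty_or_nonempty with hemp | ⟨u₀, hu₀⟩
  · rw [hemp, card_empty]; exact Nat.zero_le _
  · -- the target class is not `0` (cut 0 has class 0), so `avoid_forces_prefix` applies
    have hr : (2 * c + 2 * r₀) % 3 % 3 ≠ 0 := by
      intro h0
      apply havoid u₀ hu₀ 0 (by omega)
      unfold prefixClass
      rw [wtPrefix_zero]
      omega
    have hsub : F ⊆ univ.filter fun u : Fin n → Bool => ∀ i : Fin n, i.val < K → u i = u₀ i := by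
      intro u hu
      simp only [mem_filter, mem_univ, true_and]
      refine avoid_forces_prefix u u₀ ((2 * c + 2 * r₀) % 3) K hr hK ?_ ?_
      · intro g hg1 hgK; rw [Nat.mod_mod]; exact havoid u hu g hgK
      · intro g hg1 hgK; rw [Nat.mod_mod]; exact havoid u₀ hu₀ g hgK
    exact le_trans (card_le_card hsub) (card_cylinder_le u₀ K hK)

end Summit.QuantumAdvantage.QuantumAdvantage.Theorems.NamingDial
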